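import Literature.NumberTheory.Weil1964.AdelicMetaplecticSumStripping
import Literature.NumberTheory.Weil1964.AdelicThetaWitness
import HarnessLib

-- buildfix G11b-3 recipe (LEDGER B13-1/B13-3): elaborate sequentially so the trailing `attribute [implicit_reducible]`
-- block (reducibilityCoreExt is keyed to the async environment branch) is in force at `.olean` export.
set_option Elab.async false

/-!
# The stripping homomorphism `Mp_ψ(W₁ ⊕ W₂)ᶜᵒⁿᵗ|_{W₁ ⊕ 1} →* Mp_ψ(W₁)ᶜᵒⁿᵗ`: continuity and `Θ`-fixing

Topic `NumberTheory/Weil1964`; namespace `Literature.NumberTheory.Weil1964`. KERNEL MATHEMATICS ONLY (definitions + theorems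
over tree declarations; no `def … : Prop` record, no `axiom`, no cited hypothesis). Sequel of `AdelicMetaplecticSumStripping`.

For invertible adelic Gram matrices `T₁, T₂` and `T = T₁ ⊕ T₂`:

* §1 `leftSummandMp T₁ T₂ ≤ Mp_ψ(W₁ ⊕ W₂)ᶜᵒⁿᵗ`, the pairs lying over `Sp(W₁) ⊕ 1` (`spSum (g₁, 1)`), and the injectivity
  of `g₁ ↦ g₁ ⊕ 1` (`spSum_inl_injective`);
* §2 `strip hT₁ hT₂ p ∈ Mp_ψ(W₁)ᶜᵒⁿᵗ`, the stripped pair of `exists_strip_of_fst_eq_spSum_one` (a choice, pinned by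
  `eq_strip`: ANY `q ∈ Mp_ψ(W₁)ᶜᵒⁿᵗ` over the first block of `π p` with `ω(p)(Φ₁ ⊠ Φ₂) = ω(q) Φ₁ ⊠ Φ₂` is `strip p`), with
  `ω(p) (Φ₁ ⊠ Φ₂) = ω(strip p) Φ₁ ⊠ Φ₂` (`omega_apply_tensorToSum`) and `π(strip p) ⊕ 1 = π p` (`spSum_proj_strip`);
* §3 **`stripHom hT₁ hT₂ : leftSummandMp T₁ T₂ →* Mp_ψ(W₁)ᶜᵒⁿᵗ`** — a GROUP HOMOMORPHISM (uniqueness), CONTINUOUS for the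
  coefficient topologies (`continuous_stripHom`: one matrix coefficient `(ω(strip p)Φ₁)(x₁) = (ω(p)(Φ₁ ⊠ Φ₀))(x₁ ⊔ 0)`
  with Weil's test function `Φ₀ = thetaWitness`, `Φ₀(0) = 1`), and `Θ`-FIXING-PRESERVING (`stripHom_mem_adelicMpTheta`:
  `Θ(Φ₁ ⊠ Φ₂) = Θ(Φ₁) Θ(Φ₂)` and `Θ(Φ₀) ≠ 0`).

This is the «undoubling» functor of the doubling method: a continuous homomorphism `sD : H(𝔸) →* Mp_ψ(W ⊕ W⁻)ᶜᵒⁿᵗ` over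
`g ↦ ι(g) ⊕ 1` composed with `stripHom` is a continuous homomorphism into `Mp_ψ(W)ᶜᵒⁿᵗ` over `ι`, and it carries
`Θ`-fixing values (Weil's `r_F` on rational points) to `Θ`-fixing values [Weil1964, Chap. III n° 37–41;
MoeglinVignerasWaldspurger1987, Chap. 2 II.1 Rem. (6); GelbartRogawski1991, §3.1 Prop. 3.1.1 (the application)].

## References
* [Weil1964] A. Weil, *Sur certains groupes d'opérateurs unitaires*, Acta Math. 111 (1964), Chap. III n° 37–41.
* [MoeglinVignerasWaldspurger1987] LNM 1291 (1987), Chap. 2 II.1 Rem. (6).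
* [GelbartRogawski1991] Invent. Math. 105 (1991), §3.1 Prop. 3.1.1.

## Provenance

LEAN-IN-TREE rule (2026-08-18), pub-hodgecm model-construction sub-cell, seat own-crow gen 2 (third hand on GR-2's
[GelbartRogawski1991, Prop. 3.1.1] construction `GRSkeleton`, stub S4 «undoubling»).
-/

set_option autoImplicit false

noncomputable section

open scoped Matrix SchwartzMap TensorProduct Classical

open NumberField NumberField.mixedEmbedding IsDedekindDomain

namespace Literature.NumberTheory.Weil1964

open Literature.NumberTheory.Automorphic Literature.RepresentationTheory.HeisenbergGroup

variable {F : Type} [Field F] [NumberField F]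
variable {ι₁ ι₂ : Type} [Fintype ι₁] [Fintype ι₂] [DecidableEq ι₁] [DecidableEq ι₂]

/-! ### §1 The subgroup over `Sp(W₁) ⊕ 1` -/

section Subgroup

variable (T₁ : Matrix ι₁ ι₁ (AdeleRing (𝓞 F) F)) (T₂ : Matrix ι₂ ι₂ (AdeleRing (𝓞 F) F))

/-- **`g₁ ↦ g₁ ⊕ 1` is injective** (`(g₁ ⊕ 1)(x₁ ⊔ 0, y₁ ⊔ 0) = g₁(x₁, y₁) ⊔ 0`). [cite: Kudla1984, §1] -/
theorem spSum_inl_injective :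
    Function.Injective fun g₁ : symplecticGroup (polar (adelicForm F ι₁ T₁)) =>
      UnitaryGroup.spSum T₁ T₂ (g₁, (1 : symplecticGroup (polar (adelicForm F ι₂ T₂)))) := by
  intro g g' h
  apply Subtype.ext
  apply LinearEquiv.ext
  rintro ⟨x₁, y₁⟩
  have h1 := congrArg (fun G : symplecticGroup (polar (adelicForm F (ι₁ ⊕ ι₂) (Matrix.fromBlocks T₁ 0 0 T₂))) =>
    (G : ((ι₁ ⊕ ι₂ → AdeleRing (𝓞 F) F) × (ι₁ ⊕ ι₂ → AdeleRing (𝓞 F) F)) ≃ₗ[AdeleRing (𝓞 F) F]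
      ((ι₁ ⊕ ι₂ → AdeleRing (𝓞 F) F) × (ι₁ ⊕ ι₂ → AdeleRing (𝓞 F) F)))
      (Sum.elim x₁ (0 : ι₂ → AdeleRing (𝓞 F) F), Sum.elim y₁ (0 : ι₂ → AdeleRing (𝓞 F) F))) h
  simp only [spSum_apply_elim] at h1
  have hfst := congrArg (fun v : (ι₁ ⊕ ι₂ → AdeleRing (𝓞 F) F) × (ι₁ ⊕ ι₂ → AdeleRing (𝓞 F) F) => v.1 ∘ Sum.inl) h1
  have hsnd := congrArg (fun v : (ι₁ ⊕ ι₂ → AdeleRing (𝓞 F) F) × (ι₁ ⊕ ι₂ → AdeleRing (𝓞 F) F) => v.2 ∘ Sum.inl) h1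
  simp only [Sum.elim_comp_inl] at hfst hsnd
  exact Prod.ext hfst hsnd

/-- **`Mp_ψ(W₁ ⊕ W₂)ᶜᵒⁿᵗ|_{W₁ ⊕ 1}`**: the LF-continuous implementing pairs lying over `Sp(W₁) ⊕ 1`. [cite: Kudla1984, §1] -/
def leftSummandMp : Subgroup (adelicMpCont F (ι₁ ⊕ ι₂) (Matrix.fromBlocks T₁ 0 0 T₂)) :=
  (((UnitaryGroup.spSum T₁ T₂).comp (MonoidHom.inl _ _)).range).comap
    (adelicMpCont.proj F (ι₁ ⊕ ι₂) (Matrix.fromBlocks T₁ 0 0 T₂))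

variable {T₁ T₂}

/-- Membership: `p` lies over some `g₁ ⊕ 1`. [cite: Kudla1984, §1] -/
theorem mem_leftSummandMp_iff (p : adelicMpCont F (ι₁ ⊕ ι₂) (Matrix.fromBlocks T₁ 0 0 T₂)) :
    p ∈ leftSummandMp T₁ T₂ ↔ ∃ g₁ : symplecticGroup (polar (adelicForm F ι₁ T₁)),
      UnitaryGroup.spSum T₁ T₂ (g₁, 1) = adelicMpCont.proj F (ι₁ ⊕ ι₂) (Matrix.fromBlocks T₁ 0 0 T₂) p := by
  simp only [leftSummandMp, Subgroup.mem_comap, MonoidHom.mem_range, MonoidHom.coe_comp, Function.comp_apply,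
    MonoidHom.inl_apply]

end Subgroup

/-! ### §2 The stripped pair -/

section Strip

variable {T₁ : Matrix ι₁ ι₁ (AdeleRing (𝓞 F) F)} {T₂ : Matrix ι₂ ι₂ (AdeleRing (𝓞 F) F)}

/-- The first-summand component `g₁` of `π p = g₁ ⊕ 1` (a choice; unique by `spSum_inl_injective`). [folklore] -/
def leftProj (p : leftSummandMp T₁ T₂) : symplecticGroup (polar (adelicForm F ι₁ T₁)) :=
  Classical.choose ((mem_leftSummandMp_iff _).1 p.2)

/-- `leftProj p ⊕ 1 = π p`. [cite: Kudla1984, §1] -/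
theorem spSum_leftProj (p : leftSummandMp T₁ T₂) :
    UnitaryGroup.spSum T₁ T₂ (leftProj p, 1) =
      adelicMpCont.proj F (ι₁ ⊕ ι₂) (Matrix.fromBlocks T₁ 0 0 T₂) (p : adelicMpCont F (ι₁ ⊕ ι₂) (Matrix.fromBlocks T₁ 0 0 T₂)) :=
  Classical.choose_spec ((mem_leftSummandMp_iff _).1 p.2)

variable (hT₁ : IsUnit T₁) (hT₂ : IsUnit T₂)
include hT₁ hT₂

/-- the existence statement behind `strip`, in the bundled variables. [folklore] -/
private theorem strip_exists (p : leftSummandMp T₁ T₂) :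
    ∃ p₁ : adelicMp F ι₁ T₁, p₁ ∈ adelicMpCont F ι₁ T₁ ∧
      (p₁ : symplecticGroup (polar (adelicForm F ι₁ T₁)) × (piSchwartzBruhat F ι₁ ≃ₗ[ℂ] piSchwartzBruhat F ι₁)).1 =
        leftProj p ∧
      ∀ (Φ₁ : piSchwartzBruhat F ι₁) (Φ₂ : piSchwartzBruhat F ι₂),
        (((p : adelicMpCont F (ι₁ ⊕ ι₂) (Matrix.fromBlocks T₁ 0 0 T₂)) : adelicMp F (ι₁ ⊕ ι₂) (Matrix.fromBlocks T₁ 0 0 T₂)) :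
            symplecticGroup (polar (adelicForm F (ι₁ ⊕ ι₂) (Matrix.fromBlocks T₁ 0 0 T₂))) ×
              (piSchwartzBruhat F (ι₁ ⊕ ι₂) ≃ₗ[ℂ] piSchwartzBruhat F (ι₁ ⊕ ι₂))).2 (tensorToSum F ι₁ ι₂ Φ₁ Φ₂) =
          tensorToSum F ι₁ ι₂
            ((p₁ : symplecticGroup (polar (adelicForm F ι₁ T₁)) × (piSchwartzBruhat F ι₁ ≃ₗ[ℂ] piSchwartzBruhat F ι₁)).2 Φ₁)
            Φ₂ :=
  exists_strip_of_fst_eq_spSum_one hT₁ hT₂ _ (p : adelicMpCont F (ι₁ ⊕ ι₂) (Matrix.fromBlocks T₁ 0 0 T₂)).2 (leftProj p)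
    (spSum_leftProj p).symm

/-- **The stripped pair** `strip p = (g₁, M₁) ∈ Mp_ψ(W₁)ᶜᵒⁿᵗ` of `p = (g₁ ⊕ 1, M₁ ⊠ 1) ∈ Mp_ψ(W₁ ⊕ W₂)ᶜᵒⁿᵗ`.
[cite: MoeglinVignerasWaldspurger1987, Chap. 2 II.1 Rem. (6); Weil1964, Chap. III n° 37–38 pp. 188–190] -/
def strip (p : leftSummandMp T₁ T₂) : adelicMpCont F ι₁ T₁ :=
  ⟨Classical.choose (strip_exists hT₁ hT₂ p), (Classical.choose_spec (strip_exists hT₁ hT₂ p)).1⟩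

/-- `π(strip p) = g₁`. [cite: MoeglinVignerasWaldspurger1987, Chap. 2 II.1 Rem. (6)] -/
theorem proj_strip (p : leftSummandMp T₁ T₂) : adelicMpCont.proj F ι₁ T₁ (strip hT₁ hT₂ p) = leftProj p :=
  (Classical.choose_spec (strip_exists hT₁ hT₂ p)).2.1

/-- **`π(strip p) ⊕ 1 = π p`.** [cite: Kudla1984, §1] -/
theorem spSum_proj_strip (p : leftSummandMp T₁ T₂) :
    UnitaryGroup.spSum T₁ T₂ (adelicMpCont.proj F ι₁ T₁ (strip hT₁ hT₂ p), 1) =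
      adelicMpCont.proj F (ι₁ ⊕ ι₂) (Matrix.fromBlocks T₁ 0 0 T₂) (p : adelicMpCont F (ι₁ ⊕ ι₂) (Matrix.fromBlocks T₁ 0 0 T₂)) :=
  (congrArg (fun g : symplecticGroup (polar (adelicForm F ι₁ T₁)) => UnitaryGroup.spSum T₁ T₂ (g, 1))
    (proj_strip hT₁ hT₂ p)).trans (spSum_leftProj p)

/-- **`ω(p) (Φ₁ ⊠ Φ₂) = ω(strip p) Φ₁ ⊠ Φ₂`** for all `Φ₁, Φ₂`. [cite: MoeglinVignerasWaldspurger1987, Chap. 2 II.1 Rem. (6)] -/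
theorem omega_apply_tensorToSum (p : leftSummandMp T₁ T₂) (Φ₁ : piSchwartzBruhat F ι₁) (Φ₂ : piSchwartzBruhat F ι₂) :
    adelicMpCont.omega F (ι₁ ⊕ ι₂) (Matrix.fromBlocks T₁ 0 0 T₂) (p : adelicMpCont F (ι₁ ⊕ ι₂) (Matrix.fromBlocks T₁ 0 0 T₂))
        (tensorToSum F ι₁ ι₂ Φ₁ Φ₂) =
      tensorToSum F ι₁ ι₂ (adelicMpCont.omega F ι₁ T₁ (strip hT₁ hT₂ p) Φ₁) Φ₂ :=
  (Classical.choose_spec (strip_exists hT₁ hT₂ p)).2.2 Φ₁ Φ₂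

/-- the projection on the first block, pointwise: `π(strip p)(x₁, y₁) = (π p (x₁ ⊔ 0, y₁ ⊔ 0))|_{ι₁}`. [cite: Kudla1984, §1] -/
theorem proj_strip_apply (p : leftSummandMp T₁ T₂) (x₁ y₁ : ι₁ → AdeleRing (𝓞 F) F) :
    ((adelicMpCont.proj F ι₁ T₁ (strip hT₁ hT₂ p) : symplecticGroup (polar (adelicForm F ι₁ T₁))) :
        ((ι₁ → AdeleRing (𝓞 F) F) × (ι₁ → AdeleRing (𝓞 F) F)) ≃ₗ[AdeleRing (𝓞 F) F]
          ((ι₁ → AdeleRing (𝓞 F) F) × (ι₁ → AdeleRing (𝓞 F) F))) (x₁, y₁) =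
      ((((adelicMpCont.proj F (ι₁ ⊕ ι₂) (Matrix.fromBlocks T₁ 0 0 T₂)
            (p : adelicMpCont F (ι₁ ⊕ ι₂) (Matrix.fromBlocks T₁ 0 0 T₂)) :
            symplecticGroup (polar (adelicForm F (ι₁ ⊕ ι₂) (Matrix.fromBlocks T₁ 0 0 T₂)))) :
            ((ι₁ ⊕ ι₂ → AdeleRing (𝓞 F) F) × (ι₁ ⊕ ι₂ → AdeleRing (𝓞 F) F)) ≃ₗ[AdeleRing (𝓞 F) F]
              ((ι₁ ⊕ ι₂ → AdeleRing (𝓞 F) F) × (ι₁ ⊕ ι₂ → AdeleRing (𝓞 F) F)))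
          (Sum.elim x₁ 0, Sum.elim y₁ 0)).1 ∘ Sum.inl,
        (((adelicMpCont.proj F (ι₁ ⊕ ι₂) (Matrix.fromBlocks T₁ 0 0 T₂)
            (p : adelicMpCont F (ι₁ ⊕ ι₂) (Matrix.fromBlocks T₁ 0 0 T₂)) :
            symplecticGroup (polar (adelicForm F (ι₁ ⊕ ι₂) (Matrix.fromBlocks T₁ 0 0 T₂)))) :
            ((ι₁ ⊕ ι₂ → AdeleRing (𝓞 F) F) × (ι₁ ⊕ ι₂ → AdeleRing (𝓞 F) F)) ≃ₗ[AdeleRing (𝓞 F) F]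
              ((ι₁ ⊕ ι₂ → AdeleRing (𝓞 F) F) × (ι₁ ⊕ ι₂ → AdeleRing (𝓞 F) F)))
          (Sum.elim x₁ 0, Sum.elim y₁ 0)).2 ∘ Sum.inl) := by
  have h := congrArg (fun G : symplecticGroup (polar (adelicForm F (ι₁ ⊕ ι₂) (Matrix.fromBlocks T₁ 0 0 T₂))) =>
    (G : ((ι₁ ⊕ ι₂ → AdeleRing (𝓞 F) F) × (ι₁ ⊕ ι₂ → AdeleRing (𝓞 F) F)) ≃ₗ[AdeleRing (𝓞 F) F]
      ((ι₁ ⊕ ι₂ → AdeleRing (𝓞 F) F) × (ι₁ ⊕ ι₂ → AdeleRing (𝓞 F) F)))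
      (Sum.elim x₁ (0 : ι₂ → AdeleRing (𝓞 F) F), Sum.elim y₁ (0 : ι₂ → AdeleRing (𝓞 F) F))) (spSum_proj_strip hT₁ hT₂ p)
  simp only [spSum_apply_elim] at h
  rw [← h]
  simp only [Sum.elim_comp_inl, Prod.mk.eta]

/-- the stripped operator, one matrix coefficient: `(ω(strip p) Φ₁)(x₁) · Φ₂(x₂) = (ω(p)(Φ₁ ⊠ Φ₂))(x₁ ⊔ x₂)`.
[cite: MoeglinVignerasWaldspurger1987, Chap. 2 II.1 Rem. (6)] -/
theorem omega_strip_apply_mul (p : leftSummandMp T₁ T₂) (Φ₁ : piSchwartzBruhat F ι₁) (Φ₂ : piSchwartzBruhat F ι₂)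
    (x₁ : ι₁ → AdeleRing (𝓞 F) F) (x₂ : ι₂ → AdeleRing (𝓞 F) F) :
    ((adelicMpCont.omega F ι₁ T₁ (strip hT₁ hT₂ p) Φ₁ : piSchwartzBruhat F ι₁) : (ι₁ → AdeleRing (𝓞 F) F) → ℂ) x₁ *
        (Φ₂ : (ι₂ → AdeleRing (𝓞 F) F) → ℂ) x₂ =
      ((adelicMpCont.omega F (ι₁ ⊕ ι₂) (Matrix.fromBlocks T₁ 0 0 T₂)
          (p : adelicMpCont F (ι₁ ⊕ ι₂) (Matrix.fromBlocks T₁ 0 0 T₂)) (tensorToSum F ι₁ ι₂ Φ₁ Φ₂) :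
          piSchwartzBruhat F (ι₁ ⊕ ι₂)) : (ι₁ ⊕ ι₂ → AdeleRing (𝓞 F) F) → ℂ) (Sum.elim x₁ x₂) := by
  have h := congrArg (fun Ξ : piSchwartzBruhat F (ι₁ ⊕ ι₂) => (Ξ : (ι₁ ⊕ ι₂ → AdeleRing (𝓞 F) F) → ℂ) (Sum.elim x₁ x₂))
    (omega_apply_tensorToSum hT₁ hT₂ p Φ₁ Φ₂)
  simp only [coe_tensorToSum, boxTensor_elim] at h
  exact h.symm

/-- **Uniqueness**: any `q ∈ Mp_ψ(W₁)ᶜᵒⁿᵗ` with `π q ⊕ 1 = π p` and `ω(p)(Φ₁ ⊠ Φ₂) = ω(q) Φ₁ ⊠ Φ₂` IS `strip p`.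
[cite: MoeglinVignerasWaldspurger1987, Chap. 2 II.1 Rem. (6)] -/
theorem eq_strip (p : leftSummandMp T₁ T₂) (q : adelicMpCont F ι₁ T₁)
    (hq : UnitaryGroup.spSum T₁ T₂ (adelicMpCont.proj F ι₁ T₁ q, 1) =
      adelicMpCont.proj F (ι₁ ⊕ ι₂) (Matrix.fromBlocks T₁ 0 0 T₂) (p : adelicMpCont F (ι₁ ⊕ ι₂) (Matrix.fromBlocks T₁ 0 0 T₂)))
    (hω : ∀ (Φ₁ : piSchwartzBruhat F ι₁) (Φ₂ : piSchwartzBruhat F ι₂),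
      adelicMpCont.omega F (ι₁ ⊕ ι₂) (Matrix.fromBlocks T₁ 0 0 T₂) (p : adelicMpCont F (ι₁ ⊕ ι₂) (Matrix.fromBlocks T₁ 0 0 T₂))
          (tensorToSum F ι₁ ι₂ Φ₁ Φ₂) =
        tensorToSum F ι₁ ι₂ (adelicMpCont.omega F ι₁ T₁ q Φ₁) Φ₂) :
    q = strip hT₁ hT₂ p := by
  obtain ⟨Φ₂, hΦ₂⟩ : ∃ Φ₂ : piSchwartzBruhat F ι₂, Φ₂ ≠ 0 :=
    ⟨⟨thetaWitness F ι₂, thetaWitness_mem F ι₂⟩, fun h => thetaDistLM_thetaWitness_ne_zero F ι₂ (by rw [h, map_zero])⟩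
  apply Subtype.ext
  apply Subtype.ext
  refine Prod.ext ?_ ?_
  · exact spSum_inl_injective T₁ T₂ (hq.trans (spSum_proj_strip hT₁ hT₂ p).symm)
  · apply LinearEquiv.toLinearMap_injective
    exact strip_unique hΦ₂ fun Φ₁ => ((hω Φ₁ Φ₂).symm.trans (omega_apply_tensorToSum hT₁ hT₂ p Φ₁ Φ₂))

end Strip

/-! ### §3 The stripping homomorphism: continuity and `Θ`-fixing -/

section Hom

variable {T₁ : Matrix ι₁ ι₁ (AdeleRing (𝓞 F) F)} {T₂ : Matrix ι₂ ι₂ (AdeleRing (𝓞 F) F)}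
variable (hT₁ : IsUnit T₁) (hT₂ : IsUnit T₂)
include hT₁ hT₂

/-- the projection side of multiplicativity: `(π(strip p) π(strip q)) ⊕ 1 = π(p q)`. [folklore] -/
private theorem spSum_proj_strip_mul (p q : leftSummandMp T₁ T₂) :
    UnitaryGroup.spSum T₁ T₂ (adelicMpCont.proj F ι₁ T₁ (strip hT₁ hT₂ p * strip hT₁ hT₂ q), 1) =
      adelicMpCont.proj F (ι₁ ⊕ ι₂) (Matrix.fromBlocks T₁ 0 0 T₂)
        ((p * q : leftSummandMp T₁ T₂) : adelicMpCont F (ι₁ ⊕ ι₂) (Matrix.fromBlocks T₁ 0 0 T₂)) := by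
  have e1 := (adelicMpCont.proj F ι₁ T₁).map_mul (strip hT₁ hT₂ p) (strip hT₁ hT₂ q)
  have e2 : ((adelicMpCont.proj F ι₁ T₁ (strip hT₁ hT₂ p) * adelicMpCont.proj F ι₁ T₁ (strip hT₁ hT₂ q),
      (1 : symplecticGroup (polar (adelicForm F ι₂ T₂)))) :
        symplecticGroup (polar (adelicForm F ι₁ T₁)) × symplecticGroup (polar (adelicForm F ι₂ T₂))) =
      (adelicMpCont.proj F ι₁ T₁ (strip hT₁ hT₂ p), 1) * (adelicMpCont.proj F ι₁ T₁ (strip hT₁ hT₂ q), 1) :=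
    Prod.ext rfl (mul_one _).symm
  have h12 := (congrArg (fun g : symplecticGroup (polar (adelicForm F ι₁ T₁)) =>
    ((g, (1 : symplecticGroup (polar (adelicForm F ι₂ T₂)))) :
      symplecticGroup (polar (adelicForm F ι₁ T₁)) × symplecticGroup (polar (adelicForm F ι₂ T₂)))) e1).trans e2
  exact (congrArg (UnitaryGroup.spSum T₁ T₂) h12).trans
    ((((UnitaryGroup.spSum T₁ T₂).map_mul _ _).trans
      (congrArg₂ (· * ·) (spSum_proj_strip hT₁ hT₂ p) (spSum_proj_strip hT₁ hT₂ q))).trans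
      ((adelicMpCont.proj F (ι₁ ⊕ ι₂) (Matrix.fromBlocks T₁ 0 0 T₂)).map_mul _ _).symm)

/-- the operator side of multiplicativity. [folklore] -/
private theorem omega_mul_apply_tensorToSum (p q : leftSummandMp T₁ T₂) (Φ₁ : piSchwartzBruhat F ι₁)
    (Φ₂ : piSchwartzBruhat F ι₂) :
    adelicMpCont.omega F (ι₁ ⊕ ι₂) (Matrix.fromBlocks T₁ 0 0 T₂)
        ((p * q : leftSummandMp T₁ T₂) : adelicMpCont F (ι₁ ⊕ ι₂) (Matrix.fromBlocks T₁ 0 0 T₂)) (tensorToSum F ι₁ ι₂ Φ₁ Φ₂) =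
      tensorToSum F ι₁ ι₂ (adelicMpCont.omega F ι₁ T₁ (strip hT₁ hT₂ p * strip hT₁ hT₂ q) Φ₁) Φ₂ := by
  have h1 := LinearMap.congr_fun ((adelicMpCont.omega F (ι₁ ⊕ ι₂) (Matrix.fromBlocks T₁ 0 0 T₂)).map_mul
    (p : adelicMpCont F (ι₁ ⊕ ι₂) (Matrix.fromBlocks T₁ 0 0 T₂)) (q : adelicMpCont F (ι₁ ⊕ ι₂) (Matrix.fromBlocks T₁ 0 0 T₂)))
    (tensorToSum F ι₁ ι₂ Φ₁ Φ₂)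
  have h2 := LinearMap.congr_fun ((adelicMpCont.omega F ι₁ T₁).map_mul (strip hT₁ hT₂ p) (strip hT₁ hT₂ q)) Φ₁
  refine h1.trans ?_
  simp only [Module.End.mul_apply, h2, omega_apply_tensorToSum hT₁ hT₂]

/-- **THE STRIPPING HOMOMORPHISM** `Mp_ψ(W₁ ⊕ W₂)ᶜᵒⁿᵗ|_{W₁ ⊕ 1} →* Mp_ψ(W₁)ᶜᵒⁿᵗ`, `(g₁ ⊕ 1, M₁ ⊠ 1) ↦ (g₁, M₁)` — a
homomorphism because the stripped pair is unique. [cite: MoeglinVignerasWaldspurger1987, Chap. 2 II.1 Rem. (6);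
Weil1964, Chap. III n° 37–38 pp. 188–190] -/
def stripHom : leftSummandMp T₁ T₂ →* adelicMpCont F ι₁ T₁ :=
  MonoidHom.mk' (strip hT₁ hT₂) fun p q =>
    (eq_strip hT₁ hT₂ _ _ (spSum_proj_strip_mul hT₁ hT₂ p q) (omega_mul_apply_tensorToSum hT₁ hT₂ p q)).symm

/-- Unfolding. [cite: MoeglinVignerasWaldspurger1987, Chap. 2 II.1 Rem. (6)] -/
@[simp] theorem stripHom_apply (p : leftSummandMp T₁ T₂) : stripHom hT₁ hT₂ p = strip hT₁ hT₂ p := rfl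

/-- **`π ∘ stripHom` is the first block of `π`**: `π(stripHom p) ⊕ 1 = π p`. [cite: Kudla1984, §1] -/
theorem spSum_proj_stripHom (p : leftSummandMp T₁ T₂) :
    UnitaryGroup.spSum T₁ T₂ (adelicMpCont.proj F ι₁ T₁ (stripHom hT₁ hT₂ p), 1) =
      adelicMpCont.proj F (ι₁ ⊕ ι₂) (Matrix.fromBlocks T₁ 0 0 T₂) (p : adelicMpCont F (ι₁ ⊕ ι₂) (Matrix.fromBlocks T₁ 0 0 T₂)) :=
  spSum_proj_strip hT₁ hT₂ p

/-- **`ω ∘ stripHom` on products**: `ω(p)(Φ₁ ⊠ Φ₂) = ω(stripHom p) Φ₁ ⊠ Φ₂`. [cite: MoeglinVignerasWaldspurger1987, Chap. 2 II.1 Rem. (6)] -/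
theorem omega_apply_tensorToSum_stripHom (p : leftSummandMp T₁ T₂) (Φ₁ : piSchwartzBruhat F ι₁) (Φ₂ : piSchwartzBruhat F ι₂) :
    adelicMpCont.omega F (ι₁ ⊕ ι₂) (Matrix.fromBlocks T₁ 0 0 T₂) (p : adelicMpCont F (ι₁ ⊕ ι₂) (Matrix.fromBlocks T₁ 0 0 T₂))
        (tensorToSum F ι₁ ι₂ Φ₁ Φ₂) =
      tensorToSum F ι₁ ι₂ (adelicMpCont.omega F ι₁ T₁ (stripHom hT₁ hT₂ p) Φ₁) Φ₂ :=
  omega_apply_tensorToSum hT₁ hT₂ p Φ₁ Φ₂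

/-- **The stripping homomorphism is continuous** for the coefficient topologies of `Mp_ψ(·)ᶜᵒⁿᵗ` (initial for the
`π`-orbit maps and the matrix coefficients `p ↦ (ω(p)Φ)(x)`): both are read off the corresponding data of `p` on the
first block. [cite: Weil1964, Chap. III n° 39 p. 189] -/
theorem continuous_stripHom : Continuous (stripHom hT₁ hT₂ : leftSummandMp T₁ T₂ → adelicMpCont F ι₁ T₁) := by
  rw [continuous_into_adelicMpCont_iff, continuous_into_adelicMp_iff]
  have hval : Continuous fun z : leftSummandMp T₁ T₂ =>
      (z : adelicMpCont F (ι₁ ⊕ ι₂) (Matrix.fromBlocks T₁ 0 0 T₂)) := continuous_subtype_val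
  refine ⟨fun w => ?_, fun Φ₁ x₁ => ?_⟩
  · -- `π`-orbits: restrict the orbit of `(x₁ ⊔ 0, y₁ ⊔ 0)` to the first block
    obtain ⟨x₁, y₁⟩ := w
    have hπ := (adelicMpCont.continuous_proj_apply (F := F) (ι := ι₁ ⊕ ι₂) (T := Matrix.fromBlocks T₁ 0 0 T₂)
      (Sum.elim x₁ (0 : ι₂ → AdeleRing (𝓞 F) F), Sum.elim y₁ (0 : ι₂ → AdeleRing (𝓞 F) F))).comp hval
    have hres : Continuous fun v : (ι₁ ⊕ ι₂ → AdeleRing (𝓞 F) F) × (ι₁ ⊕ ι₂ → AdeleRing (𝓞 F) F) =>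
        ((v.1 ∘ Sum.inl, v.2 ∘ Sum.inl) : (ι₁ → AdeleRing (𝓞 F) F) × (ι₁ → AdeleRing (𝓞 F) F)) :=
      ((continuous_pi fun i => (continuous_apply (Sum.inl i)).comp continuous_fst).prodMk
        (continuous_pi fun i => (continuous_apply (Sum.inl i)).comp continuous_snd))
    refine (hres.comp hπ).congr fun z => ?_
    exact (proj_strip_apply hT₁ hT₂ z x₁ y₁).symm
  · -- matrix coefficients: `(ω(strip z)Φ₁)(x₁) = (ω(z)(Φ₁ ⊠ Φ₀))(x₁ ⊔ 0)` with `Φ₀(0) = 1`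
    have hω := (adelicMpCont.continuous_omega_apply (F := F) (ι := ι₁ ⊕ ι₂) (T := Matrix.fromBlocks T₁ 0 0 T₂)
      (tensorToSum F ι₁ ι₂ Φ₁ ⟨thetaWitness F ι₂, thetaWitness_mem F ι₂⟩) (Sum.elim x₁ 0)).comp hval
    refine hω.congr fun z => ?_
    have h := omega_strip_apply_mul hT₁ hT₂ z Φ₁ ⟨thetaWitness F ι₂, thetaWitness_mem F ι₂⟩ x₁ 0
    simp only [thetaWitness_zero, mul_one] at h
    exact h.symm

/-- **The stripping homomorphism preserves `Θ`-fixing**: if `ω(p)` fixes the theta distribution of `𝒮(𝔸_F^{ι₁ ⊕ ι₂})`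
then `ω(stripHom p)` fixes that of `𝒮(𝔸_F^{ι₁})` (`Θ(Φ₁ ⊠ Φ₀) = Θ(Φ₁) Θ(Φ₀)` with `Θ(Φ₀) ≠ 0`).
[cite: Weil1964, Chap. III n° 41 Thm 6 p. 193] -/
theorem stripHom_mem_adelicMpTheta {p : leftSummandMp T₁ T₂}
    (hp : (((p : adelicMpCont F (ι₁ ⊕ ι₂) (Matrix.fromBlocks T₁ 0 0 T₂)) :
        adelicMp F (ι₁ ⊕ ι₂) (Matrix.fromBlocks T₁ 0 0 T₂))) ∈ adelicMpTheta F (ι₁ ⊕ ι₂) (Matrix.fromBlocks T₁ 0 0 T₂)) :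
    ((stripHom hT₁ hT₂ p : adelicMpCont F ι₁ T₁) : adelicMp F ι₁ T₁) ∈ adelicMpTheta F ι₁ T₁ := by
  have hΘ₀ : thetaDistLM F ι₂ ⟨thetaWitness F ι₂, thetaWitness_mem F ι₂⟩ ≠ 0 := thetaDistLM_thetaWitness_ne_zero F ι₂
  rw [mem_adelicMpTheta_iff] at hp ⊢
  intro Φ₁
  have h := hp (tensorToSum F ι₁ ι₂ Φ₁ ⟨thetaWitness F ι₂, thetaWitness_mem F ι₂⟩)
  -- read `toOp p` as `ω(p)` and `Θ` as `thetaDistLM`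
  have h' : thetaDistLM F (ι₁ ⊕ ι₂)
      (adelicMpCont.omega F (ι₁ ⊕ ι₂) (Matrix.fromBlocks T₁ 0 0 T₂)
        (p : adelicMpCont F (ι₁ ⊕ ι₂) (Matrix.fromBlocks T₁ 0 0 T₂))
          (tensorToSum F ι₁ ι₂ Φ₁ ⟨thetaWitness F ι₂, thetaWitness_mem F ι₂⟩)) =
      thetaDistLM F (ι₁ ⊕ ι₂) (tensorToSum F ι₁ ι₂ Φ₁ ⟨thetaWitness F ι₂, thetaWitness_mem F ι₂⟩) := h
  simp only [omega_apply_tensorToSum_stripHom hT₁ hT₂, thetaDistLM_tensorToSum] at h'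
  exact mul_right_cancel₀ hΘ₀ h'

end Hom

/-! ### Build-lane note (ops-buildfix G11b-3 recipe, LEDGER B13-1, 2026-08-21)
`lean -o` (the hub build lane, never `lean`/the gate check) runs Lean 4.32's library-suggestion indexers
(`Lean.LibrarySuggestions.SymbolFrequency` / `SineQuaNon`, from their `exportEntriesFn`) over the statement of
every local theorem that is not a denied premise; on this family's statements (very large dependent binder
telescopes through the theta-kernel / dual-pair data) that fold runs for tens of minutes to hours and the build
lane kills the job (incident G11b-3, run/shared/lean/ops/buildfix/G11b-3-DOSSIER.md). `isDeniedPremise` skips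
`[implicit_reducible]` constants before any fold, and a reducibility status on a *theorem* is inert (Meta never
unfolds `thmInfo`; the kernel ignores the attribute), so the public theorems of this file are tagged
`[implicit_reducible]` purely to keep them out of that index. Only other effect: they are not offered by
`+suggestions` premise selectors. No statement or proof is changed; superseded if the operator lands a
deny-list form (`HarnessLib.PremiseIndex`). -/
set_option allowUnsafeReducibility true in
attribute [implicit_reducible]
  spSum_inl_injective mem_leftSummandMp_iff spSum_leftProj proj_strip spSum_proj_strip
  omega_apply_tensorToSum proj_strip_apply omega_strip_apply_mul eq_strip stripHom_apply
  spSum_proj_stripHom omega_apply_tensorToSum_stripHom continuous_stripHom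
  stripHom_mem_adelicMpTheta

end Literature.NumberTheory.Weil1964

end

/- build-lane note, addendum (ops-buildfix B14-5, 2026-08-22): local theorem constants the `[implicit_reducible]` block above
cannot reach — auto-realized `*.congr_simp` lemmas, structure projections / `mk.inj` / `sizeOf_spec` — are still walked by the
`.olean` exporter's premise indexers (in-file census: FOLDED = 2, proxy 4.8e+10). A global `attribute` on a realized constant lands
on an async environment branch the exporter does not consult; this file-final, top-level `local` entry goes through the
synchronous scoped extension that `getReducibilityStatusCore` reads first and is never popped before export. It is not
exported and changes no statement or proof. -/
set_option allowUnsafeReducibility true in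
attribute [local implicit_reducible]
  Literature.NumberTheory.Weil1964.stripHom.congr_simp
  Literature.NumberTheory.Weil1964.strip.congr_simp
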